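import Literature.NumberTheory.EllipticCurves.PointCountEulerCriterion
import HarnessLib

/-!
# Point counts `#Ẽ(𝔽_ℓ)` of an integer Weierstrass model by Euler's criterion in `ℕ`-arithmetic —
# a kernel certificate that scales to the Kolyvagin primes of level `2` (`ℓ ≡ 1 (mod 9)`, `ℓ ~ 10³`)
# (cell `b2b-bsdres`, team n1011, seat p03, OWNERS row T-a2-REC; kernel tool for the Kurihara-certificate
# records `Additive/X4ThreeKuriharaCertRecords*.lean`, sequel of the tree's `PointCountEulerCriterion`)

HONEST FRAMING (cell `b2b-bsdres`, run/shared/lean/b2b/bsd-rank1-residual/, verbatim in every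
file): the goal of the cell is to DELETE the COMBINATION-SHAPED residual classes of the
Birch–Swinnerton-Dyer formula for ALL analytic-rank `≤ 1` elliptic curves over `ℚ` — "full BSD
formula for every rank `≤ 1` curve in class `C`" assembled STRICTLY from published theorems — so
that the rank-`≤ 1` remainder becomes exactly the CONSTRUCTION-SHAPED classes, which are TYPED
(missing-input `Prop`s), NOT attempted. This is not "finishing BSD". Team n1011 is a RESEARCH ROUTE;
nothing is booked by this file; it is pure bookkeeping (a computable function and its identification
with the tree's point count), no named fact.

## What this file does

The records certify `ℓ ∈ 𝒫_k(E, 3)` (`3^k ∣ #Ẽ(𝔽_ℓ)`) and the surj(3) / tower witnesses from EXACT point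
counts `Nat.card Ẽ(𝔽_ℓ) = n`, proved so far by `WeierstrassCurve.natCard_point_eq_one_add_card` +
`card_sol_eq_sum_euler` + `decide +kernel` — a sum over `Finset.univ : Finset (ZMod ℓ)` of Euler terms
`d(x)^{(ℓ−1)/2}` computed in `ZMod ℓ`. That evaluation is comfortable for `ℓ ≲ 600` but exhausts the
kernel's memory near `ℓ ≈ 750` (E2-AT3 STAGE-2 DEF row `17127b1`, whose level-`2` Kolyvagin primes start
at `739`). Here the same sum is re-expressed as a closed COMPUTABLE `ℕ`-term
`affineCountNat ℓ a₁ a₂ a₃ a₄ a₆` — a `List.range` fold with `Nat.pow` / `Nat.mod` (GMP-accelerated in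
the kernel) — and identified with the tree's count:
* `affineCountNat_eq_sum_euler` / `card_sol_map_eq_affineCountNat`: for an odd prime `ℓ` and an integer
  model `E₀ = [a₁, a₂, a₃, a₄, a₆]`, the number of affine solutions of `E₀ mod ℓ` is `affineCountNat ℓ …`;
* `natCard_point_map_eq` : `Nat.card (E₀ mod ℓ)(𝔽_ℓ) = 1 + affineCountNat ℓ a₁ a₂ a₃ a₄ a₆` when
  `Δ(E₀) ≢ 0 (mod ℓ)`;
so a record proves `#Ẽ(𝔽_ℓ) = n` by `rw [natCard_point_map_eq …]; decide +kernel` in time `O(ℓ log ℓ)`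
big-integer operations and negligible memory (self-tests below at `ℓ = 757`, `1153`).

References: [IrelandRosen1990] Prop. 5.1.2, §8.1–8.2; [CremonaAlgorithms1997] §2.4, §3.5;
[SilvermanAEC2009] V.1 (Hasse) and Ex. 5.10.
-/

set_option autoImplicit false

namespace Summit.BirchSwinnertonDyer.Rank1Residual.Additive.PointCountNat

open WeierstrassCurve Finset Literature.NumberTheory.EllipticCurves

/-! ### §1 The computable count -/

/-- Euler's term for a residue `d mod ℓ` (`ℓ` an odd prime): `1` if `d ≡ 0`, `2` if `d` is a non-zero
square (`d^{(ℓ−1)/2} ≡ 1`), `0` otherwise — in `ℕ`-arithmetic. [cite: IrelandRosen1990, Prop. 5.1.2] -/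
def eulerTerm (ℓ d : ℕ) : ℕ :=
  if d % ℓ = 0 then 1 else if d ^ (ℓ / 2) % ℓ = 1 then 2 else 0

/-- The column discriminant `d(x) = (a₁x + a₃)² + 4(x³ + a₂x² + a₄x + a₆)` of a Weierstrass equation,
as an integer. [cite: IrelandRosen1990, §8.2] -/
def discInt (a₁ a₂ a₃ a₄ a₆ x : ℤ) : ℤ :=
  (a₁ * x + a₃) ^ 2 + 4 * (x ^ 3 + a₂ * x ^ 2 + a₄ * x + a₆)

/-- The residue in `{0, …, ℓ−1}` of the column discriminant at `x ∈ ℕ`. [folklore] -/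
def discMod (ℓ : ℕ) (a₁ a₂ a₃ a₄ a₆ : ℤ) (x : ℕ) : ℕ :=
  Int.toNat (discInt a₁ a₂ a₃ a₄ a₆ x % (ℓ : ℤ))

/-- **The number of affine solutions of `y² + a₁xy + a₃y = x³ + a₂x² + a₄x + a₆` over `𝔽_ℓ`**, `ℓ` an
odd prime, as a closed computable `ℕ`-term (Euler's criterion column by column; `Nat.pow`/`Nat.mod`,
kernel-evaluable for `ℓ` in the thousands). [cite: IrelandRosen1990, §8.1–8.2] [cite: CremonaAlgorithms1997, §2.4] -/
def affineCountNat (ℓ : ℕ) (a₁ a₂ a₃ a₄ a₆ : ℤ) : ℕ :=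
  ((List.range ℓ).map fun x => eulerTerm ℓ (discMod ℓ a₁ a₂ a₃ a₄ a₆ x)).sum

/-! ### §2 Identification with the tree's Euler sum -/

variable {ℓ : ℕ} [hℓ : Fact ℓ.Prime]

/-- The residue `discMod` casts to the column discriminant in `ZMod ℓ`. [folklore] -/
theorem natCast_discMod (a₁ a₂ a₃ a₄ a₆ : ℤ) (x : ℕ) :
    ((discMod ℓ a₁ a₂ a₃ a₄ a₆ x : ℕ) : ZMod ℓ) = (discInt a₁ a₂ a₃ a₄ a₆ x : ZMod ℓ) := by
  have hℓ0 : (0 : ℤ) < ℓ := by exact_mod_cast hℓ.out.pos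
  have hnn : 0 ≤ discInt a₁ a₂ a₃ a₄ a₆ x % (ℓ : ℤ) := Int.emod_nonneg _ hℓ0.ne'
  unfold discMod
  rw [← Int.cast_natCast (R := ZMod ℓ), Int.toNat_of_nonneg hnn, ZMod.intCast_mod]

/-- `discMod < ℓ`. [folklore] -/
theorem discMod_lt (a₁ a₂ a₃ a₄ a₆ : ℤ) (x : ℕ) : discMod ℓ a₁ a₂ a₃ a₄ a₆ x < ℓ := by
  have hℓ0 : (0 : ℤ) < ℓ := by exact_mod_cast hℓ.out.pos
  have hlt : discInt a₁ a₂ a₃ a₄ a₆ x % (ℓ : ℤ) < ℓ := Int.emod_lt_of_pos _ hℓ0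
  have hnn : 0 ≤ discInt a₁ a₂ a₃ a₄ a₆ x % (ℓ : ℤ) := Int.emod_nonneg _ hℓ0.ne'
  unfold discMod
  omega

/-- Euler's term in `ℕ`-arithmetic agrees with the tree's `ZMod ℓ` term. [cite: IrelandRosen1990, Prop. 5.1.2] -/
theorem eulerTerm_eq_ite (d : ℕ) :
    eulerTerm ℓ d = (if (d : ZMod ℓ) = 0 then 1 else if (d : ZMod ℓ) ^ (Fintype.card (ZMod ℓ) / 2) = 1
      then 2 else 0) := by
  have h1 : ((1 : ℕ) : ZMod ℓ) = 1 := Nat.cast_one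
  have hone : 1 % ℓ = 1 := Nat.mod_eq_of_lt hℓ.out.one_lt
  have e0 : (d : ZMod ℓ) = 0 ↔ d % ℓ = 0 := by
    rw [ZMod.natCast_eq_zero_iff, Nat.dvd_iff_mod_eq_zero]
  have e1 : (d : ZMod ℓ) ^ (Fintype.card (ZMod ℓ) / 2) = 1 ↔ d ^ (ℓ / 2) % ℓ = 1 := by
    rw [ZMod.card, ← Nat.cast_pow, ← h1, ZMod.natCast_eq_natCast_iff', hone]
  unfold eulerTerm
  by_cases h0 : d % ℓ = 0
  · rw [if_pos h0, if_pos (e0.mpr h0)]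
  · rw [if_neg h0, if_neg (fun h => h0 (e0.mp h))]
    by_cases hsq : d ^ (ℓ / 2) % ℓ = 1
    · rw [if_pos hsq, if_pos (e1.mpr hsq)]
    · rw [if_neg hsq, if_neg (fun h => hsq (e1.mp h))]

/-- A `Finset.range` sum is the sum of the mapped `List.range`. [folklore] -/
theorem sum_range_eq_sum_map_range (f : ℕ → ℕ) (n : ℕ) :
    ∑ i ∈ Finset.range n, f i = ((List.range n).map f).sum := by
  induction n with
  | zero => simp
  | succ n ih => rw [Finset.sum_range_succ, ih, List.range_succ, List.map_append, List.sum_append]; simp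

/-- Re-indexing a sum over `ZMod ℓ` by the residues `0, …, ℓ - 1`. [folklore] -/
theorem sum_zmod_eq_sum_range (g : ZMod ℓ → ℕ) :
    ∑ x : ZMod ℓ, g x = ∑ n ∈ Finset.range ℓ, g (n : ZMod ℓ) := by
  haveI : NeZero ℓ := ⟨hℓ.out.ne_zero⟩
  symm
  refine Finset.sum_nbij (fun n : ℕ => (n : ZMod ℓ)) (fun _ _ => Finset.mem_univ _) ?_ ?_ (fun _ _ => rfl)
  · intro a ha b hb hab
    have ha' : a < ℓ := Finset.mem_range.mp (Finset.mem_coe.mp ha)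
    have hb' : b < ℓ := Finset.mem_range.mp (Finset.mem_coe.mp hb)
    have h := (ZMod.natCast_eq_natCast_iff' a b ℓ).mp hab
    rwa [Nat.mod_eq_of_lt ha', Nat.mod_eq_of_lt hb'] at h
  · intro x _
    exact ⟨x.val, Finset.mem_coe.mpr (Finset.mem_range.mpr (ZMod.val_lt x)), ZMod.natCast_zmod_val x⟩

/-- **The number of affine solutions of `E₀ mod ℓ` equals `affineCountNat ℓ a₁ a₂ a₃ a₄ a₆`** (`ℓ` an odd
prime; `E₀ = [a₁, a₂, a₃, a₄, a₆]` an integer model). [cite: IrelandRosen1990, §8.1–8.2] [cite: CremonaAlgorithms1997, §2.4] -/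
theorem card_sol_map_eq_affineCountNat (hℓ2 : ℓ ≠ 2) (a₁ a₂ a₃ a₄ a₆ : ℤ) :
    Fintype.card {xy : ZMod ℓ × ZMod ℓ //
        xy.2 ^ 2 + ((⟨a₁, a₂, a₃, a₄, a₆⟩ : WeierstrassCurve ℤ).map (Int.castRingHom (ZMod ℓ))).a₁ * xy.1 * xy.2
          + ((⟨a₁, a₂, a₃, a₄, a₆⟩ : WeierstrassCurve ℤ).map (Int.castRingHom (ZMod ℓ))).a₃ * xy.2
        = xy.1 ^ 3 + ((⟨a₁, a₂, a₃, a₄, a₆⟩ : WeierstrassCurve ℤ).map (Int.castRingHom (ZMod ℓ))).a₂ * xy.1 ^ 2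
          + ((⟨a₁, a₂, a₃, a₄, a₆⟩ : WeierstrassCurve ℤ).map (Int.castRingHom (ZMod ℓ))).a₄ * xy.1
          + ((⟨a₁, a₂, a₃, a₄, a₆⟩ : WeierstrassCurve ℤ).map (Int.castRingHom (ZMod ℓ))).a₆}
      = affineCountNat ℓ a₁ a₂ a₃ a₄ a₆ := by
  have hchar : ringChar (ZMod ℓ) ≠ 2 := by rw [ZMod.ringChar_zmod_n]; exact hℓ2
  rw [card_sol_eq_sum_euler hchar, sum_zmod_eq_sum_range, affineCountNat, ← sum_range_eq_sum_map_range]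
  refine Finset.sum_congr rfl fun n _ => ?_
  rw [eulerTerm_eq_ite, natCast_discMod]
  have hD : (((⟨a₁, a₂, a₃, a₄, a₆⟩ : WeierstrassCurve ℤ).map (Int.castRingHom (ZMod ℓ))).a₁ * (n : ZMod ℓ)
        + ((⟨a₁, a₂, a₃, a₄, a₆⟩ : WeierstrassCurve ℤ).map (Int.castRingHom (ZMod ℓ))).a₃) ^ 2
      + 4 * ((n : ZMod ℓ) ^ 3 + ((⟨a₁, a₂, a₃, a₄, a₆⟩ : WeierstrassCurve ℤ).map (Int.castRingHom (ZMod ℓ))).a₂ * (n : ZMod ℓ) ^ 2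
        + ((⟨a₁, a₂, a₃, a₄, a₆⟩ : WeierstrassCurve ℤ).map (Int.castRingHom (ZMod ℓ))).a₄ * (n : ZMod ℓ)
        + ((⟨a₁, a₂, a₃, a₄, a₆⟩ : WeierstrassCurve ℤ).map (Int.castRingHom (ZMod ℓ))).a₆)
      = (discInt a₁ a₂ a₃ a₄ a₆ n : ZMod ℓ) := by
    simp only [map_a₁, map_a₂, map_a₃, map_a₄, map_a₆, eq_intCast, discInt]
    push_cast
    ring
  rw [hD]

/-- **`#Ẽ(𝔽_ℓ) = 1 + affineCountNat ℓ a₁ a₂ a₃ a₄ a₆`** for the reduction modulo an odd prime `ℓ` of an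
integer model `E₀ = [a₁, a₂, a₃, a₄, a₆]` with `Δ(E₀ mod ℓ) ≠ 0` — the records' point-count certificate in
`ℕ`-arithmetic (`rw [natCard_point_map_eq …]; decide +kernel`). [cite: CremonaAlgorithms1997, §2.4 and §3.5]
[cite: IrelandRosen1990, §8.1–8.2] -/
theorem natCard_point_map_eq (hℓ2 : ℓ ≠ 2) (a₁ a₂ a₃ a₄ a₆ : ℤ)
    (hΔ : ((⟨a₁, a₂, a₃, a₄, a₆⟩ : WeierstrassCurve ℤ).map (Int.castRingHom (ZMod ℓ))).Δ ≠ 0) :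
    Nat.card ((⟨a₁, a₂, a₃, a₄, a₆⟩ : WeierstrassCurve ℤ).map (Int.castRingHom (ZMod ℓ))).toAffine.Point
      = 1 + affineCountNat ℓ a₁ a₂ a₃ a₄ a₆ := by
  rw [natCard_point_eq_one_add_card _ hΔ, card_sol_map_eq_affineCountNat hℓ2]

/-! ### §3 Self-tests at the sizes the records need -/

/-- `#Ẽ(𝔽₅)(73206p1) = 5` (the surj(3) witness of `X4ThreeKuriharaCertRecords2`; agrees with the Euler-sum
certificate of record). [folklore] -/
theorem natCard_v73206p1_5 :
    Nat.card (((⟨1, -1, 0, -926064391464, -343480532333653184⟩ : WeierstrassCurve ℤ).map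
      (Int.castRingHom (ZMod 5))).toAffine.Point) = 5 := by
  rw [natCard_point_map_eq (hℓ := ⟨by norm_num⟩) (by norm_num) 1 (-1) 0 (-926064391464) (-343480532333653184) (by decide +kernel)]
  decide +kernel

/-- `#Ẽ(𝔽₇₅₇)(17127b1) = 792` — a level-`2` Kolyvagin prime of the E2-AT3 STAGE-2 DEF row `17127b1`
(`757 ≡ 1 (mod 9)`, `9 ∣ 792`), out of reach of the `ZMod`-sum certificate, in about a second here.
[folklore] -/
theorem natCard_v17127b1_757 :
    Nat.card (((⟨1, -1, 1, -19163564, -34134737802⟩ : WeierstrassCurve ℤ).map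
      (Int.castRingHom (ZMod 757))).toAffine.Point) = 792 := by
  rw [natCard_point_map_eq (hℓ := ⟨by norm_num⟩) (by norm_num) 1 (-1) 1 (-19163564) (-34134737802) (by decide +kernel)]
  decide +kernel

/-- `#Ẽ(𝔽₁₁₅₃)(17127b1) = 1152` (`1153 ≡ 1 (mod 9)`, `9 ∣ 1152`: the third level-`2` Kolyvagin prime
`< 1200` of `17127b1`) — cost gauge at `ℓ > 10³`. [folklore] -/
theorem natCard_v17127b1_1153 :
    Nat.card (((⟨1, -1, 1, -19163564, -34134737802⟩ : WeierstrassCurve ℤ).map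
      (Int.castRingHom (ZMod 1153))).toAffine.Point) = 1152 := by
  rw [natCard_point_map_eq (hℓ := ⟨by norm_num⟩) (by norm_num) 1 (-1) 1 (-19163564) (-34134737802) (by decide +kernel)]
  decide +kernel

end Summit.BirchSwinnertonDyer.Rank1Residual.Additive.PointCountNat
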